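import Summits.ValiantsHypothesis.ValiantsHypothesis.Theorems.LacunarySymmetroidPencilTransfer
import Summits.ValiantsHypothesis.ValiantsHypothesis.Theorems.LacunarySymmetroidThetaWitness

/-!
# `MatrixDescartes` — the route's size regime is `2^(O(log² K))`, not `2^((log K + c)^c)`; with the ratio and i.o. savings

CONDITIONAL: proves no part of MatrixDescartes; the hypothesis below (ratio form, infinitely often, sizes
`≤ 2^(c·(⌊log₂K⌋+1)²)`) is OPEN and implies VH by this theorem, hence ≥ summit-hard; ROUTE-DESIGN DATUM: the transfer
delivers pencils of size `2^(O((log n)²))`, so the crux is consumed only at sizes quasi-polynomial OF EXPONENT TWO.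

HONEST FRAMING.  Object-search cell `pub-symmetroid`, crux `Theses.LacunarySymmetroid.MatrixDescartes`
(ledger item `stmt-ValiantsHypothesis-18050`, route `LacunarySymmetroid`; seat `val-sym-mdr-p1`).  Companion of
`…CensusRatioCloses.lean` (ratio `b/a < 1` suffices; infinitely often suffices) and `…CensusRatioWindow.lean` (only
the window `m ≳ K^(2−1/(t+1))` matters).  This file sharpens the TOP of the window.  The route's typed transfer
`PencilTransfer` (stmt-18051, PROVED) states sizes `m ≤ 2^((⌊log₂n⌋+c)^c)`; but its own proof chain (tree
`Literature.Computability.AlgebraicComplexity.determinantalComplexity_le_two_pow`: `dc(fₙ) ≤ 2^(17E²)` with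
`deg fₙ, L(fₙ) < 2^E`, `E = (⌊log₂n⌋+1)·A`; then the symmetric affine representation of size `4·dc³ + 7`, tree
`SymmetroidDescartes.hasSymmAffineDetRepr_of_hasDetRepr`, and the pointwise pencil identity
`LacunarySymmetroid.pencilTransfer_pointwise`) gives the sharper `m ≤ 2^(c·(⌊log₂n⌋+1)²)` (`pencilTransfer_logSq`).
Consequently (`valiant_of_matrixDescartesRatio_logSq_io`): for `b < a`, if for every `c` and every `K₁` SOME `K ≥ K₁`
has `Z^a ≤ 2^(b·K⌊log₂K⌋)` for every `K`-term real symmetric `m × m` lacunary pencil with `m ≤ 2^(c·(⌊log₂K⌋+1)²)`, then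
`VP ≠ VNP` over `ℂ`; the «eventually» form follows (`valiant_of_matrixDescartesRatio_logSq`).  Since
`c(ℓ+1)² ≤ (ℓ+c')^(c')` for suitable `c'`, these hypotheses are WEAKER than the corresponding ones with the crux's
size regime: the summit-bearing content of the route sits at sizes `K^(2−δ) ≲ m ≤ 2^(O(log² K))` (with the residual
conditions of `…CensusResidual.lean`), where a constant-factor saving over the witness rate `K log₂ K` is needed
infinitely often.  Nothing here bears on `DoorA26` / `DoorA34` or any census numeral; no new `Prop` is registered.

[folklore] The transfer chain of `pencilTransfer_proof` with its exponent bookkeeping kept quadratic; the closing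
argument of `Theses.LacunarySymmetroid.closes`.
-/

-- `Summit.ValiantsHypothesis.ValiantsHypothesis.…` repeats a component by the D-0017 layout
-- (single-conjunct summit), which the `dupNamespace` linter flags; the name is mandated.
set_option linter.dupNamespace false

noncomputable section

namespace Summit.ValiantsHypothesis.ValiantsHypothesis.Theorems.LacunarySymmetroidMatrixDescartes.Census

open Literature.Computability.AlgebraicComplexity
open scoped BigOperators

/-! ## §1 The transfer with quadratic exponent -/

/-- Size bookkeeping: `dc ≤ 2^(17E²)`, `E = (ℓ+1)A` ⟹ `4 dc³ + 7 ≤ 2^((51A²+3)(ℓ+1)²)`. [folklore] -/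
theorem logSq_size_bound {dc ℓ A : ℕ} (hA : 1 ≤ A) (hdc : dc ≤ 2 ^ (17 * ((ℓ + 1) * A) ^ 2)) :
    4 * dc ^ 3 + 7 ≤ 2 ^ ((51 * A ^ 2 + 3) * (ℓ + 1) ^ 2) := by
  set e := 17 * ((ℓ + 1) * A) ^ 2 with he
  have hlA : 1 ≤ (ℓ + 1) * A := Nat.one_le_iff_ne_zero.2 (Nat.mul_ne_zero (by omega) (by omega))
  have he1 : 1 ≤ e := by rw [he]; nlinarith
  have h2e : 2 ≤ 2 ^ (3 * e) :=
    calc 2 = 2 ^ 1 := (pow_one 2).symm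
      _ ≤ 2 ^ (3 * e) := Nat.pow_le_pow_right (by norm_num) (by omega)
  have h1 : dc ^ 3 ≤ 2 ^ (3 * e) :=
    calc dc ^ 3 ≤ (2 ^ e) ^ 3 := Nat.pow_le_pow_left hdc 3
      _ = 2 ^ (3 * e) := by rw [← pow_mul, mul_comm]
  have h2 : 4 * dc ^ 3 + 7 ≤ 2 ^ (3 * e + 3) := by
    have e1 : 2 ^ (3 * e + 3) = 2 ^ (3 * e) * 8 := by rw [pow_add]; norm_num
    rw [e1]
    omega
  refine h2.trans (Nat.pow_le_pow_right (by norm_num) ?_)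
  have h3 : 1 ≤ (ℓ + 1) ^ 2 := Nat.one_le_pow _ _ (Nat.succ_pos ℓ)
  have e2 : 3 * e + 3 = 51 * A ^ 2 * (ℓ + 1) ^ 2 + 3 := by rw [he]; ring
  rw [e2]
  nlinarith

/-- **The pencil transfer with quadratic exponent.**  For every real family `f` whose complexification is a VP family
and every exponent data `d`, there is `c` such that for every `n` some real SYMMETRIC lacunary pencil with `v(n)+1`
terms (exponents `0, d n 0, …`) and size `m ≤ 2^(c·(⌊log₂n⌋+1)²)` has determinant with the same set of real zeros as
`fₙ(X^(d n 0), …)`.  Same chain as the tree's `LacunarySymmetroid.pencilTransfer_proof` (descent to `ℝ`, VP ⇒ dc,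
GKKP symmetrisation, restriction to the monomial curve), with the dc bound kept in its native form `2^(17E²)`
(`determinantalComplexity_le_two_pow`) instead of being rounded up to `2^((⌊log₂n⌋+c)^c)`. [folklore] -/
theorem pencilTransfer_logSq (v : ℕ → ℕ) (f : ∀ n, MvPolynomial (Fin (v n)) ℝ)
    (hf : IsVPFamily (fun n => MvPolynomial.map (algebraMap ℝ ℂ) (f n))) (d : ∀ n, Fin (v n) → ℕ) :
    ∃ c : ℕ, ∀ n : ℕ, ∃ m : ℕ, m ≤ 2 ^ (c * (Nat.log 2 n + 1) ^ 2) ∧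
      ∃ S : Fin (v n + 1) → Matrix (Fin m) (Fin m) ℝ, (∀ l, (S l).IsSymm) ∧
        (Matrix.det (∑ l, ((Polynomial.X : Polynomial ℝ) ^ (Fin.cons (α := fun _ => ℕ) (0 : ℕ) (d n) l)) •
            (S l).map Polynomial.C)).roots.toFinset =
          (MvPolynomial.aeval (fun i => (Polynomial.X : Polynomial ℝ) ^ d n i) (f n)).roots.toFinset := by
  have hVP := LacunarySymmetroid.isVPFamily_real_of_complex v f hf
  obtain ⟨⟨-, hdegp⟩, hLp⟩ := hVP
  obtain ⟨A₁, hA₁, hdeg⟩ := IsPBounded.exists_lt_two_pow hdegp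
  obtain ⟨A₂, -, hL⟩ := IsPBounded.exists_lt_two_pow hLp
  set A := A₁ + A₂ with hA
  refine ⟨51 * A ^ 2 + 3, fun n => ?_⟩
  set E := (Nat.log 2 n + 1) * A with hE
  have hE1 : 1 ≤ E := Nat.one_le_iff_ne_zero.2 (Nat.mul_ne_zero (by omega) (by omega))
  have hEd : (Nat.log 2 n + 1) * A₁ ≤ E := Nat.mul_le_mul_left _ (by omega)
  have hEL : (Nat.log 2 n + 1) * A₂ ≤ E := Nat.mul_le_mul_left _ (by omega)
  have hd : (f n).totalDegree < 2 ^ E :=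
    (hdeg n).trans_le (Nat.pow_le_pow_right (by norm_num) hEd)
  have hc : complexity (f n) ≤ 2 ^ E :=
    ((hL n).trans_le (Nat.pow_le_pow_right (by norm_num) hEL)).le
  have hdc : determinantalComplexity (f n) ≤ 2 ^ (17 * E ^ 2) :=
    determinantalComplexity_le_two_pow le_rfl hd hc hE1
  obtain ⟨B, hsymm, hB⟩ :=
    Summit.ValiantsHypothesis.ValiantsHypothesis.Theorems.SymmetroidDescartes.hasSymmAffineDetRepr_of_hasDetRepr
      (k := ℝ) two_ne_zero (hasDetRepr_determinantalComplexity_holds (f n))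
  obtain ⟨S, hS, hroots⟩ := LacunarySymmetroid.pencilTransfer_pointwise (f n) B hsymm hB (d n)
  exact ⟨4 * determinantalComplexity (f n) ^ 3 + 7, logSq_size_bound (by omega) (by rw [hE] at hdc; exact hdc), S, hS,
    hroots⟩

/-! ## §2 The summit from the ratio form, infinitely often, at sizes `2^(O(log² K))` -/

/-- **The route at quadratic-exponent sizes, infinitely often.**  Let `b < a`.  If for every `c` and every `K₁` there
is some `K ≥ K₁` such that every `K`-term real symmetric `m × m` lacunary pencil with `m ≤ 2^(c·(⌊log₂K⌋+1)²)` has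
`Z^a ≤ 2^(b·K⌊log₂K⌋)`, then `VP ≠ VNP` over `ℂ`.  (The witness `thetaWitness_proof` holds for all large `n`, the
transfer `pencilTransfer_logSq` for all `n`; the arithmetic is that of `Census.valiant_of_matrixDescartesRatio`.)
CONDITIONAL: the hypothesis is OPEN and at least summit-hard. [folklore] -/
theorem valiant_of_matrixDescartesRatio_logSq_io (a b : ℕ) (hab : b < a)
    (h : ∀ c K₁ : ℕ, ∃ K : ℕ, K₁ ≤ K ∧ ∀ m : ℕ, m ≤ 2 ^ (c * (Nat.log 2 K + 1) ^ 2) →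
      ∀ (d : Fin K → ℕ) (S : Fin K → Matrix (Fin m) (Fin m) ℝ), (∀ l, (S l).IsSymm) →
        (Matrix.det (∑ l, ((Polynomial.X : Polynomial ℝ) ^ d l) • (S l).map Polynomial.C)).roots.toFinset.card ^ a
          ≤ 2 ^ (b * (K * Nat.log 2 K))) :
    _root_.ValiantsHypothesis := by
  show Literature.Computability.AlgebraicComplexity.VP ℂ ≠ Literature.Computability.AlgebraicComplexity.VNP ℂ
  intro hEq
  obtain ⟨Θ, d, hVNP, n₀, hroots⟩ := LacunarySymmetroid.thetaWitness_proof
  have hVP : Literature.Computability.AlgebraicComplexity.IsVPFamily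
      (fun n => MvPolynomial.map (algebraMap ℝ ℂ) (Θ n)) := by
    have hmem := (Literature.Computability.AlgebraicComplexity.mem_VNP_ofFintype_iff_holds _).2 hVNP
    rw [← hEq] at hmem
    exact (Literature.Computability.AlgebraicComplexity.mem_VP_ofFintype_iff_holds _).1 hmem
  obtain ⟨c, hc⟩ := pencilTransfer_logSq (fun n => n) Θ hVP d
  obtain ⟨N, hN⟩ : ∃ N : ℕ, 2 ^ (2 * b + 1) = N := ⟨_, rfl⟩
  obtain ⟨K, hK₁, hK⟩ := h c (n₀ + N + a + b + 3)
  obtain ⟨n, rfl⟩ : ∃ n, K = n + 1 := ⟨K - 1, by omega⟩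
  have hn₀ : n₀ ≤ n := by omega
  have hnB : 2 ^ (2 * b + 1) ≤ n := by rw [hN]; omega
  have hnA : a + b + 2 ≤ n := by omega
  obtain ⟨m, hm, S, hS, hroot⟩ := hc n
  set Z := (MvPolynomial.aeval (fun i => (Polynomial.X : Polynomial ℝ) ^ d n i) (Θ n)).roots.toFinset.card
    with hZ
  have hm' : m ≤ 2 ^ (c * (Nat.log 2 (n + 1) + 1) ^ 2) :=
    hm.trans (Nat.pow_le_pow_right (by norm_num) (Nat.mul_le_mul_left _
      (Nat.pow_le_pow_left (Nat.add_le_add_right (Nat.log_mono_right (Nat.le_succ n)) 1) 2)))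
  have h1 := hK m hm' (Fin.cons (α := fun _ => ℕ) (0 : ℕ) (d n)) S hS
  rw [hroot] at h1
  have h2 : 2 ^ (n * Nat.log 2 n) ≤ Z + 1 := hroots n hn₀
  set L := Nat.log 2 n with hL
  have hL2 : 2 * b + 1 ≤ L := by
    rw [hL]
    exact Nat.le_log_of_pow_le one_lt_two hnB
  have hLn : L ≤ n := by rw [hL]; exact Nat.log_le_self 2 n
  have hL' : Nat.log 2 (n + 1) ≤ L + 1 := by
    rw [hL]
    calc Nat.log 2 (n + 1) ≤ Nat.log 2 (n * 2) := Nat.log_mono_right (by omega)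
      _ = Nat.log 2 n + 1 := Nat.log_mul_base (by norm_num) (by omega)
  have h3 : Z ^ a ≤ 2 ^ (b * ((n + 1) * (L + 1))) :=
    h1.trans (Nat.pow_le_pow_right (by norm_num) (Nat.mul_le_mul_left _ (Nat.mul_le_mul_left _ hL')))
  have hnL : 1 ≤ n * L := by nlinarith
  have h4 : 2 ^ (n * L - 1) ≤ Z := by
    have e : 2 ^ (n * L) = 2 * 2 ^ (n * L - 1) := by
      rw [← Nat.pow_succ']
      congr 1
      omega
    have h2' := h2
    rw [e] at h2'
    have : 1 ≤ 2 ^ (n * L - 1) := Nat.one_le_two_pow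
    omega
  have h5 : 2 ^ (a * (n * L - 1)) ≤ Z ^ a := by
    rw [pow_mul']
    exact Nat.pow_le_pow_left h4 a
  have h6 : a * (n * L - 1) ≤ b * ((n + 1) * (L + 1)) :=
    (Nat.pow_le_pow_iff_right (by norm_num)).1 (h5.trans h3)
  have i1 : (b + 1) * (n * L - 1) ≤ a * (n * L - 1) := Nat.mul_le_mul_right _ hab
  have i2 : n * (2 * b + 1) ≤ n * L := Nat.mul_le_mul_left n hL2
  have i3 : b * L ≤ b * n := Nat.mul_le_mul_left b hLn
  have e1 : (b + 1) * (n * L - 1) = b * (n * L - 1) + (n * L - 1) := by ring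
  have e2 : n * (2 * b + 1) = 2 * (b * n) + n := by ring
  have e3 : b * ((n + 1) * (L + 1)) = b * (n * L - 1) + b * n + b * L + 2 * b := by
    have e : (n + 1) * (L + 1) = (n * L - 1) + n + L + 2 := by
      zify [hnL]
      ring
    rw [e]
    ring
  rw [e1] at i1
  rw [e2] at i2
  rw [e3] at h6
  generalize hP : n * L - 1 = P at i1 h6
  have hP1 : P + 1 = n * L := by omega
  generalize hQ : b * P = Q at i1 h6
  generalize hR : a * P = R at i1 h6
  generalize hbn : b * n = U at i2 i3 h6
  generalize hbL : b * L = V at i3 h6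
  generalize hnL' : n * L = W at i2 hP1
  omega

/-- The «eventually» form at quadratic-exponent sizes. [folklore] -/
theorem valiant_of_matrixDescartesRatio_logSq (a b : ℕ) (hab : b < a)
    (h : ∀ c : ℕ, ∃ K₀ : ℕ, ∀ K m : ℕ, K₀ ≤ K → m ≤ 2 ^ (c * (Nat.log 2 K + 1) ^ 2) →
      ∀ (d : Fin K → ℕ) (S : Fin K → Matrix (Fin m) (Fin m) ℝ), (∀ l, (S l).IsSymm) →
        (Matrix.det (∑ l, ((Polynomial.X : Polynomial ℝ) ^ d l) • (S l).map Polynomial.C)).roots.toFinset.card ^ a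
          ≤ 2 ^ (b * (K * Nat.log 2 K))) :
    _root_.ValiantsHypothesis := by
  refine valiant_of_matrixDescartesRatio_logSq_io a b hab fun c K₁ => ?_
  obtain ⟨K₀, hK₀⟩ := h c
  exact ⟨max K₀ K₁, le_max_right _ _, fun m hm d S hS => hK₀ _ m (le_max_left _ _) hm d S hS⟩

/-- The quadratic-exponent regime is contained in the crux's regime: `c(ℓ+1)² ≤ (ℓ + (c+2))^(c+2)`; so every
hypothesis of this file is implied by the corresponding one stated with `m ≤ 2^((⌊log₂K⌋+c')^(c'))` for all `c'`.
[folklore] -/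
theorem logSq_le_polylog (c ℓ : ℕ) : c * (ℓ + 1) ^ 2 ≤ (ℓ + (c + 2)) ^ (c + 2) := by
  have h1 : (ℓ + 1) ^ 2 ≤ (ℓ + (c + 2)) ^ 2 := Nat.pow_le_pow_left (by omega) 2
  have h2 : (ℓ + (c + 2)) ^ 2 * (ℓ + (c + 2)) ^ c = (ℓ + (c + 2)) ^ (c + 2) := by
    rw [← pow_add]; congr 1; ring
  have h3 : c ≤ (ℓ + (c + 2)) ^ c := by
    rcases Nat.eq_zero_or_pos c with rfl | hc
    · simp
    · calc c ≤ ℓ + (c + 2) := by omega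
        _ = (ℓ + (c + 2)) ^ 1 := (pow_one _).symm
        _ ≤ (ℓ + (c + 2)) ^ c := Nat.pow_le_pow_right (by omega) hc
  calc c * (ℓ + 1) ^ 2 ≤ (ℓ + (c + 2)) ^ c * (ℓ + (c + 2)) ^ 2 := Nat.mul_le_mul h3 h1
    _ = (ℓ + (c + 2)) ^ (c + 2) := by rw [mul_comm, h2]

end Summit.ValiantsHypothesis.ValiantsHypothesis.Theorems.LacunarySymmetroidMatrixDescartes.Census

end
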